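/-
Copyright (c) 2026. All rights reserved.
Released under Apache 2.0 license as described in the file LICENSE.
Authors: HodgeCM publication cell (pub-hodgecm), model-construction sub-cell, construction prover `mc-weil-2`.
-/
import Literature.RepresentationTheory.HarrisKudlaSweet1996.Splittings
import Literature.NumberTheory.Automorphic.QuadraticHeckeCharacterCM
import Literature.NumberTheory.Automorphic.GlobalAdditiveCharacter
import Literature.NumberTheory.GaloisRepresentations.HeckeCharacterExtensionQuadraticCMProofs
import HarnessLib

/-!
# The global splitting characters `(χ_V, χ_W)` of a unitary dual pair over a CM field

Topic `RepresentationTheory/HarrisKudlaSweet1996`; namespace `Literature.RepresentationTheory.HarrisKudlaSweet1996`.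

Source: M. Harris, S. Kudla, W. Sweet, *Theta dichotomy for unitary groups*, JAMS 9 (1996) [HarrisKudlaSweet1996],
§1, (1.5) p. 951: "If `dim_E V = m`, we choose a character `χ = χ_V` of `E^×` such that `χ_V|_{F^×} = ε^m_{E/F}`"
— the character datum of Kudla's splitting `U(V) → Mp(𝕎)` [Kudla1994, §3]; the same condition for the second
member `W` of the pair (`dim W = n`, character `χ_W` with `χ_W|_{F^×} = ε^n`).  The tree already types the PRINTED
local/abstract form as `HarrisKudlaSweet1996.Partner.Admissible` (`Splittings.lean`).

THIS FILE fixes the GLOBAL form of this datum for a CM field `L` over its maximal totally real subfield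
`L⁺ = maximalRealSubfield L` (so `E = L`, `F = L⁺`), using ONLY tree objects:
* `ε_{L/L⁺} = Automorphic.quadraticHeckeCharCM L : HeckeCharacter L⁺` (`QuadraticHeckeCharacterCM.lean`),
* the base change of idèles `𝕀_{L⁺} → 𝕀_L`, `Automorphic.AdeleRing.ideleBaseChange L⁺ L`,
* Hecke characters `GaloisRepresentations.HeckeCharacter L` and `HeckeCharacter.IsUnitary`,
* global additive characters `Automorphic.IsGlobalAddChar` and the standard one `Automorphic.adeleAddChar L⁺`
  (`isGlobalAddChar_adeleAddChar`, kernel).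

WHAT IS CONSTRUCTED / PROVED (kernel, no cited fact):
* `IsSplittingChar L m χ : Prop` — `χ (x_L) = ε(x)^m` for every idèle `x` of `L⁺`; `isSplittingChar_iff_admissible`
  (it IS the printed (1.5) record `Partner.Admissible` for `toE := ideleBaseChange L⁺ L`, `ε := ε_{L/L⁺}`);
  `isSplittingChar_iff_mod_two` (only the parity of `m` matters, `ε² = 1`), `IsSplittingChar.mul/.inv/.pow`,
  `isSplittingChar_one` (`χ = 1` for even `m`);
* `SplittingCharacters L m n` — the pair `(χ_V, χ_W)` of UNITARY Hecke characters of `L` with `χ_V| = ε^m`,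
  `χ_W| = ε^n` (a data structure: nothing asserted), `SplittingCharacters.ofOne` (both members as powers of ONE
  character extending `ε`), `SplittingCharacters.trivial` (even `m, n`);
* `GlobalSplittingData L m n` — the same together with a global additive character `ψ` of `𝔸_{L⁺}/L⁺`;
  `GlobalSplittingData.std` (the standard `ψ = adeleAddChar L⁺`);
* **`exists_isUnitary_isSplittingChar_one`** — a unitary Hecke character `χ` of `L` with `χ|_{𝕀_{L⁺}} = ε_{L/L⁺}`
  EXISTS: the tree's kernel theorem
  `GaloisRepresentations.HeckeCharacter.exists_extension_quadratic_of_isTotallyComplex_of_isFiniteOrder`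
  (Weil's extension method, `HeckeCharacterExtensionQuadraticCMProofs.lean`) applied to `χ₀ = ε` (finite order);
  hence **`nonempty_splittingCharacters`**, **`nonempty_globalSplittingData`** for ALL `m, n` — the
  non-degeneracy witness of the datum.

NOT here: the local components `χ_{V,v}` on `(L ⊗ L⁺_v)^×` and Kudla's local splitting `β_{V,χ}` itself
(`Splittings.lean` types its printed shape; its splitting PROPERTY is [Kudla1994, Thm. 3.1]); archimedean types
of `χ_V, χ_W` (they affect the weights of theta lifts, not the splitting).

## References

* [HarrisKudlaSweet1996] M. Harris, S. Kudla, W. Sweet, JAMS 9 (1996), §1 (1.5) p. 951.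
* [Kudla1994] S. Kudla, Israel J. Math. 87 (1994), §3.
* [Weil1956] A. Weil, *On a certain type of characters of the idèle-class group…* (1956), §1 (the extension method).
-/

noncomputable section

open scoped NumberField
open NumberField

namespace Literature.RepresentationTheory.HarrisKudlaSweet1996

open _root_.Literature.NumberTheory.GaloisRepresentations
open _root_.Literature.NumberTheory.Automorphic

variable (L : Type) [Field L] [NumberField L] [IsCMField L]

local notation3 "L⁺" => maximalRealSubfield L

/-! ## 1. The splitting condition (1.5) -/

/-- **The splitting condition [HarrisKudlaSweet1996, (1.5) p. 951] for a Hecke character of the CM field `L`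
over `F = L⁺`:** `χ|_{𝕀_{L⁺}} = ε_{L/L⁺}^m`, i.e. `χ(x_L) = ε(x)^m` for every idèle `x` of `L⁺` (`x_L` its base
change to `𝕀_L`).  For `m = dim V` this is the condition on `χ_V`. [cite: HarrisKudlaSweet1996, (1.5) p. 951] -/
def IsSplittingChar (m : ℕ) (χ : HeckeCharacter L) : Prop :=
  ∀ x : ideleGroup L⁺, χ (AdeleRing.ideleBaseChange L⁺ L x) = quadraticHeckeCharCM L x ^ m

variable {L}

/-- `IsSplittingChar` IS the tree's printed record `Partner.Admissible` [(1.5) p. 951] instantiated with the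
idèle groups `Eu := 𝕀_L`, `Fu := 𝕀_{L⁺}`, the base change `toE := ideleBaseChange L⁺ L`, `ε := ε_{L/L⁺}` (for any
value of the unused field `det`). [cite: HarrisKudlaSweet1996, (1.5) p. 951] -/
theorem isSplittingChar_iff_admissible (m : ℕ) (χ : HeckeCharacter L) (d : ideleGroup L⁺) :
    IsSplittingChar L m χ ↔
      (Partner.mk m d (χ : ideleGroup L →* ℂˣ)).Admissible (AdeleRing.ideleBaseChange L⁺ L)
        (quadraticHeckeCharCM L : ideleGroup L⁺ →* ℂˣ) :=
  Iff.rfl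

/-- `ε(x)^m` depends only on `m mod 2` (`ε(x)² = 1`). [folklore] -/
theorem quadraticHeckeCharCM_pow_eq_pow_mod_two (x : ideleGroup L⁺) (m : ℕ) :
    quadraticHeckeCharCM L x ^ m = quadraticHeckeCharCM L x ^ (m % 2) := by
  conv_lhs => rw [← Nat.mod_add_div m 2, pow_add, pow_mul, quadraticHeckeCharCM_apply_sq, one_pow, mul_one]

/-- only the PARITY of `m` matters in (1.5). [folklore] -/
theorem isSplittingChar_iff_mod_two (m : ℕ) (χ : HeckeCharacter L) :
    IsSplittingChar L m χ ↔ IsSplittingChar L (m % 2) χ :=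
  forall_congr' fun x => by rw [quadraticHeckeCharCM_pow_eq_pow_mod_two]

/-- for EVEN `m` the condition is `χ|_{𝕀_{L⁺}} = 1`. [folklore] -/
theorem isSplittingChar_iff_of_even {m : ℕ} (hm : Even m) (χ : HeckeCharacter L) :
    IsSplittingChar L m χ ↔ ∀ x : ideleGroup L⁺, χ (AdeleRing.ideleBaseChange L⁺ L x) = 1 :=
  forall_congr' fun x => by
    rw [quadraticHeckeCharCM_pow_eq_pow_mod_two, Nat.even_iff.mp hm, pow_zero]

/-- for ODD `m` the condition is `χ|_{𝕀_{L⁺}} = ε`. [folklore] -/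
theorem isSplittingChar_iff_of_odd {m : ℕ} (hm : Odd m) (χ : HeckeCharacter L) :
    IsSplittingChar L m χ ↔
      ∀ x : ideleGroup L⁺, χ (AdeleRing.ideleBaseChange L⁺ L x) = quadraticHeckeCharCM L x :=
  forall_congr' fun x => by
    rw [quadraticHeckeCharCM_pow_eq_pow_mod_two, Nat.odd_iff.mp hm, pow_one]

/-- the trivial character satisfies (1.5) for even `m`. [folklore] -/
theorem isSplittingChar_one {m : ℕ} (hm : Even m) : IsSplittingChar L m 1 :=
  (isSplittingChar_iff_of_even hm 1).mpr fun _ => rfl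

/-- (1.5) is multiplicative: `χ₁| = ε^{m₁}`, `χ₂| = ε^{m₂}` ⇒ `(χ₁χ₂)| = ε^{m₁+m₂}` (the character of an orthogonal
sum `V₁ ⊕ V₂`, cf. `Partner.Admissible.sum`). [folklore] -/
theorem IsSplittingChar.mul {m₁ m₂ : ℕ} {χ₁ χ₂ : HeckeCharacter L} (h₁ : IsSplittingChar L m₁ χ₁)
    (h₂ : IsSplittingChar L m₂ χ₂) : IsSplittingChar L (m₁ + m₂) (χ₁ * χ₂) := fun x => by
  rw [HeckeCharacter.mul_apply, h₁ x, h₂ x, pow_add]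

/-- (1.5) is stable under inversion (`ε^m` is its own inverse). [folklore] -/
theorem IsSplittingChar.inv {m : ℕ} {χ : HeckeCharacter L} (h : IsSplittingChar L m χ) :
    IsSplittingChar L m χ⁻¹ := fun x => by
  rw [HeckeCharacter.inv_apply, h x, inv_eq_iff_mul_eq_one, ← pow_add, ← two_mul, pow_mul,
    quadraticHeckeCharCM_apply_sq, one_pow]

/-- powers: `χ| = ε^m` ⇒ `χ^k| = ε^{mk}`. [folklore] -/
theorem IsSplittingChar.pow {m : ℕ} {χ : HeckeCharacter L} (h : IsSplittingChar L m χ) (k : ℕ) :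
    IsSplittingChar L (m * k) (χ ^ k) := fun x => by
  rw [HeckeCharacter.pow_apply, h x, pow_mul]

/-! ## 2. The data: `(χ_V, χ_W)` and `ψ` -/

variable (L)

/-- **The splitting characters of a unitary dual pair `(U(V), U(W))` over the CM field `L`**, `dim V = m`,
`dim W = n`: UNITARY Hecke characters `χ_V, χ_W` of `L` with `χ_V|_{𝕀_{L⁺}} = ε^m`, `χ_W|_{𝕀_{L⁺}} = ε^n`
[HarrisKudlaSweet1996, (1.5) p. 951, for both members of the pair].  A data structure; nothing is asserted
(inhabited for all `m, n`: `nonempty_splittingCharacters`). [cite: HarrisKudlaSweet1996, (1.5) p. 951] -/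
structure SplittingCharacters (m n : ℕ) where
  /-- `χ_V` -/
  χV : HeckeCharacter L
  /-- `χ_V` is unitary -/
  χV_isUnitary : χV.IsUnitary
  /-- `χ_V|_{𝕀_{L⁺}} = ε^m` -/
  χV_splitting : IsSplittingChar L m χV
  /-- `χ_W` -/
  χW : HeckeCharacter L
  /-- `χ_W` is unitary -/
  χW_isUnitary : χW.IsUnitary
  /-- `χ_W|_{𝕀_{L⁺}} = ε^n` -/
  χW_splitting : IsSplittingChar L n χW

/-- **The global splitting data**: the splitting characters together with a non-trivial additive character
`ψ` of `𝔸_{L⁺}/L⁺` (the datum "fix `ψ`" of the Weil representation `ω_ψ`). [cite: HarrisKudlaSweet1996, §1] -/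
structure GlobalSplittingData (m n : ℕ) extends SplittingCharacters L m n where
  /-- the additive character `ψ` of `𝔸_{L⁺}` -/
  ψ : AddChar (AdeleRing (𝓞 L⁺) L⁺) Circle
  /-- `ψ` is continuous, trivial on `L⁺`, non-trivial -/
  isGlobalAddChar : IsGlobalAddChar L⁺ ψ

variable {L}

namespace SplittingCharacters

variable {m n : ℕ}

omit [IsCMField L] in
/-- a unitary character has unitary powers. [folklore] -/
theorem isUnitary_pow {χ : HeckeCharacter L} (hχ : χ.IsUnitary) (k : ℕ) : (χ ^ k).IsUnitary := fun x => by
  rw [HeckeCharacter.pow_apply, Units.val_pow_eq_pow_val, norm_pow, hχ x, one_pow]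

/-- **Both splitting characters from ONE character extending `ε`**: if `χ` is unitary with `χ|_{𝕀_{L⁺}} = ε`,
then `(χ^m, χ^n)` are splitting characters for `(dim V, dim W) = (m, n)`. [folklore] -/
def ofOne (χ : HeckeCharacter L) (hu : χ.IsUnitary) (h : IsSplittingChar L 1 χ) (m n : ℕ) :
    SplittingCharacters L m n where
  χV := χ ^ m
  χV_isUnitary := isUnitary_pow hu m
  χV_splitting := by simpa using h.pow m
  χW := χ ^ n
  χW_isUnitary := isUnitary_pow hu n
  χW_splitting := by simpa using h.pow n

/-- the trivial pair for EVEN dimensions. [folklore] -/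
def trivial (hm : Even m) (hn : Even n) : SplittingCharacters L m n where
  χV := 1
  χV_isUnitary := fun x => by simp
  χV_splitting := isSplittingChar_one hm
  χW := 1
  χW_isUnitary := fun x => by simp
  χW_splitting := isSplittingChar_one hn

/-- with the STANDARD additive character `ψ = adeleAddChar L⁺` (Tate's `e^{2πiΛ}`; a global additive character by
the tree's `isGlobalAddChar_adeleAddChar`). [folklore] -/
def std (S : SplittingCharacters L m n) : GlobalSplittingData L m n where
  toSplittingCharacters := S
  ψ := adeleAddChar L⁺
  isGlobalAddChar := isGlobalAddChar_adeleAddChar L⁺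

end SplittingCharacters

/-! ## 3. Existence (kernel): a unitary Hecke character of `L` extending `ε_{L/L⁺}` -/

/-- `ε_{L/L⁺}` has finite order (`ε² = 1`). [folklore] -/
theorem isFiniteOrder_quadraticHeckeCharCM : (quadraticHeckeCharCM L).IsFiniteOrder :=
  isOfFinOrder_iff_pow_eq_one.mpr ⟨2, two_pos, quadraticHeckeCharCM_sq L⟩

/-- **A unitary Hecke character `χ` of the CM field `L` with `χ|_{𝕀_{L⁺}} = ε_{L/L⁺}` exists** — the tree's kernel
theorem `HeckeCharacter.exists_extension_quadratic_of_isTotallyComplex_of_isFiniteOrder` (Weil's extension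
method along the CM quadratic extension `L/L⁺`, complex conjugation `IsCMField.complexConj L`, no places to keep
unramified) applied to the finite-order character `χ₀ = ε_{L/L⁺}`. [folklore] -/
theorem exists_isUnitary_isSplittingChar_one : ∃ χ : HeckeCharacter L, χ.IsUnitary ∧ IsSplittingChar L 1 χ := by
  obtain ⟨χ, hu, hres, -⟩ :=
    HeckeCharacter.exists_extension_quadratic_of_isTotallyComplex_of_isFiniteOrder L⁺ L (IsCMField.complexConj L)
      (Algebra.IsQuadraticExtension.finrank_eq_two L⁺ L) (IsCMField.complexConj_ne_one L) inferInstance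
      inferInstance (quadraticHeckeCharCM L) isFiniteOrder_quadraticHeckeCharCM ∅ (fun _ h => h.elim)
  exact ⟨χ, hu, fun x => (hres x).trans (pow_one _).symm⟩

/-- **Splitting characters exist for every `(m, n)`.** [folklore] -/
theorem nonempty_splittingCharacters (m n : ℕ) : Nonempty (SplittingCharacters L m n) := by
  obtain ⟨χ, hu, h⟩ := exists_isUnitary_isSplittingChar_one (L := L)
  exact ⟨SplittingCharacters.ofOne χ hu h m n⟩

/-- **Global splitting data exist for every `(m, n)`.** [folklore] -/
theorem nonempty_globalSplittingData (m n : ℕ) : Nonempty (GlobalSplittingData L m n) :=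
  (nonempty_splittingCharacters m n).map SplittingCharacters.std

end Literature.RepresentationTheory.HarrisKudlaSweet1996

end
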